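import Summits.AtomisticToContinuum.HydrodynamicLimit.Theorems.JParityClosureAssemblyEnergyModulus

/-!
# Route JParityClosure — `Assembly` (stmt-AtomisticToContinuum-17595): the ENERGY field at a fixed
# instant — the equicontinuity input and where the two missing hypotheses are consumed

Companion of `JParityClosureAssemblyEnergyModulus.lean` (pathwise modulus
`abs_energyObservable_flow_sub_le`). Here the modulus is turned into probabilities:

* `measure_setOf_lt_abs_sub_le` — the increment event `{δ < |E_N(s) − E_N(t)|}` is covered by the
  three bad events `{K < E_kin/(N+1)}`, `{η₁ < (N+1)⁻¹∫_t^{u₁} 𝒯³_M}`, `{η₂ < (ε/(N+1))·½𝒮ᴱ(t,u₂]}`;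
* `hequi_energy_of_energy_of_cubic_of_jump` / `hequi_energy_localGibbs` — the hypothesis `hequi` of
  `tendsto_measure_fixedTime_of_timeAverage` for `E_N(s) = (N+1)⁻¹Σᵢ ϑ(xᵢ(s))|vᵢ(s)|²/2`, from energy
  tightness (under the conjunct's `t = 0` LLN: `configEnergy_tight_localGibbs`) and the two windowed
  hypotheses `hcubic` (cubic streaming tail — implied by `EnergyCurrentTails`, stmt-9235, via Markov and
  Tonelli) and `hjump` (absolute collisional energy transfer in small windows);
* `tendsto_energyObservable_fixedTime_localGibbs` — the upgrade run (dictionary to the conjunct's energy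
  field: the tree's `ChaosClosesEulerReadout.empiricalEnergyField_eq_energyObservable`).

`hcubic` and `hjump` are exactly what the item's hypothesis `X` does not provide (gap G1 of the item's
notes); with them, the time-averaged identification `havg` is all that remains of the energy third of
the conclusion at a fixed instant. No new objects.
-/

noncomputable section

namespace Summit.AtomisticToContinuum.HydrodynamicLimit.Theorems.JParityClosureEnergyModulus

open Set MeasureTheory Filter Topology Function
open scoped ENNReal InnerProductSpace
open Literature.Analysis.FluidPDE Literature.Analysis.FunctionSpaces
open Literature.MathematicalPhysics.KineticTheory
open Summit.AtomisticToContinuum.HydrodynamicLimit.Theorems.JParityClosureMomentumModulus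

variable {d : Type*} [Fintype d]

/-- **From the pathwise modulus to deviation probabilities** (law `P` not charging the bad set,
`‖Dϑ‖ ≤ C`, `0 ≤ C, ε, M`, `t ≤ s ≤ u₁, u₂`, normalisation `m > 0`,
`(s − t)·C·M·K + C·½η₁ + C·η₂ ≤ δ`): the increment event is covered by the three bad events
`{K < m⁻¹E_kin}`, `{η₁ < m⁻¹∫_t^{u₁} 𝒯³_M}`, `{η₂ < ε m⁻¹ ½𝒮ᴱ(t, u₂]}`. [folklore] -/
theorem measure_setOf_lt_abs_sub_le {ε : ℝ} {N : ℕ}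
    (Φ : HardSphereFlow (Torus.geometry d) ε N) (P : Measure (Config N d (UnitAddTorus d)))
    (hP : P Φ.goodᶜ = 0) {ϑ : UnitAddTorus d → ℝ} (hϑ : Torus.IsContDiff 1 ϑ) {C : ℝ}
    (hC : ∀ x, ‖Torus.fderiv ϑ x‖ ≤ C) (hC0 : 0 ≤ C) (hε : 0 ≤ ε) {M : ℝ} (hM : 0 ≤ M)
    {t s u₁ u₂ : ℝ} (hts : t ≤ s) (hsu₁ : s ≤ u₁) (hsu₂ : s ≤ u₂) {m K η₁ η₂ δ : ℝ} (hm : 0 < m)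
    (hδ : (s - t) * (C * M * K) + C * (2⁻¹ * η₁) + C * η₂ ≤ δ) :
    P {z | δ < |m⁻¹ * energyObservable ϑ (Φ.flow s z) - m⁻¹ * energyObservable ϑ (Φ.flow t z)|} ≤
      P {z | K < m⁻¹ * configEnergy z} +
        P {z | η₁ < m⁻¹ * ∫ r in t..u₁, ∑ i, {w : EuclideanSpace ℝ d | M < ‖w‖}.indicator
          (fun w => ‖w‖ ^ 3) (Φ.flow r z i).2} +
        P {z | η₂ < ε * m⁻¹ * (2⁻¹ * collisionalTransferFunctional (Torus.geometry d) ε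
          (fun i _ pre post => |‖(post i).2‖ ^ 2 - ‖(pre i).2‖ ^ 2| / 2)
            (fun r => Φ.flow r z) t u₂)} := by
  set T : Config N d (UnitAddTorus d) → ℝ := fun z =>
    ∑ i, {w : EuclideanSpace ℝ d | M < ‖w‖}.indicator (fun w => ‖w‖ ^ 3) (z i).2 with hT
  set g : Fin N → Fin N → Config N d (UnitAddTorus d) → Config N d (UnitAddTorus d) → ℝ :=
    fun i _ pre post => |‖(post i).2‖ ^ 2 - ‖(pre i).2‖ ^ 2| / 2 with hg
  have hT0 : ∀ z, 0 ≤ T z := fun z =>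
    Finset.sum_nonneg fun i _ => indicator_nonneg (fun w _ => by positivity) _
  set A : Set (Config N d (UnitAddTorus d)) := {z | K < m⁻¹ * configEnergy z} with hA
  set B₁ : Set (Config N d (UnitAddTorus d)) :=
    {z | η₁ < m⁻¹ * ∫ r in t..u₁, T (Φ.flow r z)} with hB₁
  set B₂ : Set (Config N d (UnitAddTorus d)) := {z | η₂ < ε * m⁻¹ * (2⁻¹ *
    collisionalTransferFunctional (Torus.geometry d) ε g (fun r => Φ.flow r z) t u₂)} with hB₂
  have hsub : {z | δ < |m⁻¹ * energyObservable ϑ (Φ.flow s z) -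
      m⁻¹ * energyObservable ϑ (Φ.flow t z)|} ⊆ Φ.goodᶜ ∪ (A ∪ B₁ ∪ B₂) := by
    intro z hz
    rw [mem_setOf_eq] at hz
    by_contra hcon
    simp only [hA, hB₁, hB₂, mem_union, mem_compl_iff, mem_setOf_eq, not_or, not_not, not_lt]
      at hcon
    obtain ⟨hzg, ⟨hK, hη₁⟩, hη₂⟩ := hcon
    have htraj := Φ.isTrajectory z hzg
    set Its := ∫ r in t..s, T (Φ.flow r z) with hIts
    set Itu := ∫ r in t..u₁, T (Φ.flow r z) with hItu
    set Sts := collisionalTransferFunctional (Torus.geometry d) ε g (fun r => Φ.flow r z) t s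
    set Stu := collisionalTransferFunctional (Torus.geometry d) ε g (fun r => Φ.flow r z) t u₂
    have key := abs_energyObservable_flow_sub_le Φ hzg hϑ hC hM hts
    have hImono : Its ≤ Itu :=
      intervalIntegral.integral_mono_interval le_rfl hts hsu₁
        (Eventually.of_forall fun r => hT0 _) (intervalIntegrable_cubicTail htraj M (hts.trans hsu₁))
    have hSmono : Sts ≤ Stu :=
      collisionalTransferFunctional_mono_right htraj (fun _ _ _ _ => by positivity) hts hsu₂
    have habs : |m⁻¹ * energyObservable ϑ (Φ.flow s z) - m⁻¹ * energyObservable ϑ (Φ.flow t z)| =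
        m⁻¹ * |energyObservable ϑ (Φ.flow s z) - energyObservable ϑ (Φ.flow t z)| := by
      rw [← mul_sub, abs_mul, abs_of_pos (inv_pos.2 hm)]
    rw [habs] at hz
    have hm0 : 0 ≤ m⁻¹ := (inv_pos.2 hm).le
    have h1 : m⁻¹ * |energyObservable ϑ (Φ.flow s z) - energyObservable ϑ (Φ.flow t z)| ≤
        (s - t) * (C * M * (m⁻¹ * configEnergy z)) + C * (2⁻¹ * (m⁻¹ * Its)) +
          C * (ε * m⁻¹ * (2⁻¹ * Sts)) := by
      have := mul_le_mul_of_nonneg_left key hm0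
      calc _ ≤ _ := this
        _ = _ := by ring
    have h2 : (s - t) * (C * M * (m⁻¹ * configEnergy z)) ≤ (s - t) * (C * M * K) :=
      mul_le_mul_of_nonneg_left (mul_le_mul_of_nonneg_left hK (by positivity)) (sub_nonneg.2 hts)
    have h3 : C * (2⁻¹ * (m⁻¹ * Its)) ≤ C * (2⁻¹ * η₁) := by
      refine mul_le_mul_of_nonneg_left (mul_le_mul_of_nonneg_left (le_trans ?_ hη₁) (by norm_num))
        hC0
      exact mul_le_mul_of_nonneg_left hImono hm0
    have h4 : C * (ε * m⁻¹ * (2⁻¹ * Sts)) ≤ C * η₂ := by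
      refine mul_le_mul_of_nonneg_left (le_trans ?_ hη₂) hC0
      have hεm : 0 ≤ ε * m⁻¹ := mul_nonneg hε hm0
      nlinarith
    linarith
  calc P {z | δ < |m⁻¹ * energyObservable ϑ (Φ.flow s z) -
          m⁻¹ * energyObservable ϑ (Φ.flow t z)|}
      ≤ P (Φ.goodᶜ ∪ (A ∪ B₁ ∪ B₂)) := measure_mono hsub
    _ ≤ P Φ.goodᶜ + P (A ∪ B₁ ∪ B₂) := measure_union_le _ _
    _ ≤ P Φ.goodᶜ + (P A + P B₁ + P B₂) := by
        gcongr
        exact (measure_union_le _ _).trans (by gcongr; exact measure_union_le _ _)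
    _ = P A + P B₁ + P B₂ := by rw [hP, zero_add]

/-- **Equicontinuity in probability of the normalised energy observable** — the hypothesis `hequi`
of `tendsto_measure_fixedTime_of_timeAverage` for `X_N(s) = (N+1)⁻¹ Σᵢ ϑ(xᵢ(s))|vᵢ(s)|²/2` — from
(i) tightness of the kinetic energy per particle, (ii) `hcubic`: a windowed bound in probability on
`(N+1)⁻¹ ∫_t^{t+Δ} 𝒯³_M` for some level `M ≥ 0`, (iii) `hjump`: one on the normalised energy-jump
statistic `(ε_N/(N+1))·½𝒮ᴱ(t, t+Δ]`. [folklore] -/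
theorem hequi_energy_of_energy_of_cubic_of_jump {εN : ℕ → ℝ} (hε : ∀ N, 0 ≤ εN N)
    (P : ∀ N : ℕ, Measure (Config (N + 1) d (UnitAddTorus d)))
    (Φ : ∀ N : ℕ, HardSphereFlow (Torus.geometry d) (εN N) (N + 1))
    (hgood : ∀ N, P N (Φ N).goodᶜ = 0)
    {ϑ : UnitAddTorus d → ℝ} (hϑ : Torus.IsContDiff 1 ϑ) (t : ℝ) {Δ₀ : ℝ} (hΔ₀ : 0 < Δ₀)
    (henergy : ∀ κ : ℝ, 0 < κ → ∃ K : ℝ, ∃ N₁ : ℕ, ∀ N, N₁ ≤ N →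
      P N {z | K < ((N : ℝ) + 1)⁻¹ * configEnergy z} ≤ ENNReal.ofReal κ)
    (hcubic : ∀ η : ℝ, 0 < η → ∀ κ : ℝ, 0 < κ → ∃ M : ℝ, 0 ≤ M ∧ ∃ Δ : ℝ, 0 < Δ ∧ ∃ N₂ : ℕ,
      ∀ N, N₂ ≤ N → P N {z | η < ((N : ℝ) + 1)⁻¹ * ∫ r in t..(t + Δ), ∑ i,
        {w : EuclideanSpace ℝ d | M < ‖w‖}.indicator (fun w => ‖w‖ ^ 3) ((Φ N).flow r z i).2} ≤
        ENNReal.ofReal κ)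
    (hjump : ∀ η : ℝ, 0 < η → ∀ κ : ℝ, 0 < κ → ∃ Δ : ℝ, 0 < Δ ∧ ∃ N₃ : ℕ, ∀ N, N₃ ≤ N →
      P N {z | η < εN N * ((N : ℝ) + 1)⁻¹ * (2⁻¹ *
        collisionalTransferFunctional (Torus.geometry d) (εN N)
          (fun i _ pre post => |‖(post i).2‖ ^ 2 - ‖(pre i).2‖ ^ 2| / 2)
          (fun r => (Φ N).flow r z) t (t + Δ))} ≤ ENNReal.ofReal κ) :
    ∀ δ : ℝ, 0 < δ → ∀ κ : ℝ, 0 < κ → ∃ Δ : ℝ, 0 < Δ ∧ Δ ≤ Δ₀ ∧ ∃ N₀ : ℕ, ∀ N, N₀ ≤ N →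
      ∀ s ∈ Ioo t (t + Δ),
        P N {z | δ < |((N : ℝ) + 1)⁻¹ * energyObservable ϑ ((Φ N).flow s z) -
          ((N : ℝ) + 1)⁻¹ * energyObservable ϑ ((Φ N).flow t z)|} ≤ ENNReal.ofReal κ := by
  intro δ hδ κ hκ
  obtain ⟨C, hC0, hC⟩ := exists_fderiv_le hϑ
  obtain ⟨K, N₁, hK⟩ := henergy (κ / 3) (by positivity)
  set K' : ℝ := max K 1 with hK'def
  have hK'pos : 0 < K' := lt_of_lt_of_le one_pos (le_max_right _ _)
  set η : ℝ := δ / (3 * (C + 1)) with hηdef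
  have hη : 0 < η := by positivity
  obtain ⟨M, hM, Δ₁, hΔ₁, N₂, hI⟩ := hcubic η hη (κ / 3) (by positivity)
  obtain ⟨Δ₂, hΔ₂, N₃, hS⟩ := hjump η hη (κ / 3) (by positivity)
  have hden : 0 < 3 * C * M * K' + 3 := by positivity
  set Δ' : ℝ := min (min (min Δ₁ Δ₂) Δ₀) (δ / (3 * C * M * K' + 3)) with hΔ'def
  have hΔ'pos : 0 < Δ' := lt_min (lt_min (lt_min hΔ₁ hΔ₂) hΔ₀) (div_pos hδ hden)
  refine ⟨Δ', hΔ'pos, (min_le_left _ _).trans (min_le_right _ _), max (max N₁ N₂) N₃,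
    fun N hN s hs => ?_⟩
  have hts : t ≤ s := hs.1.le
  have hmin : Δ' ≤ min Δ₁ Δ₂ := (min_le_left _ _).trans (min_le_left _ _)
  have hsu₁ : s ≤ t + Δ₁ := by linarith [hs.2, hmin.trans (min_le_left _ _)]
  have hsu₂ : s ≤ t + Δ₂ := by linarith [hs.2, hmin.trans (min_le_right _ _)]
  have harith : (s - t) * (C * M * K') + C * (2⁻¹ * η) + C * η ≤ δ := by
    have h1 : s - t ≤ δ / (3 * C * M * K' + 3) := by
      linarith [hs.2, min_le_right (min (min Δ₁ Δ₂) Δ₀) (δ / (3 * C * M * K' + 3))]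
    have h2 : (s - t) * (C * M * K') ≤ δ / 3 := by
      have hCK : 0 ≤ C * M * K' := by positivity
      calc (s - t) * (C * M * K') ≤ δ / (3 * C * M * K' + 3) * (C * M * K') :=
            mul_le_mul_of_nonneg_right h1 hCK
        _ ≤ δ / 3 := by
            rw [div_mul_eq_mul_div, div_le_div_iff₀ hden three_pos]
            nlinarith
    have h3 : C * η ≤ δ / 3 := by
      rw [hηdef, ← mul_div_assoc, div_le_div_iff₀ (by positivity) three_pos]
      nlinarith
    nlinarith
  have hm : (0 : ℝ) < (N : ℝ) + 1 := by positivity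
  have hN₁ : N₁ ≤ N := le_trans (le_max_left _ _) (le_of_max_le_left hN)
  have hN₂ : N₂ ≤ N := le_trans (le_max_right _ _) (le_of_max_le_left hN)
  have hN₃ : N₃ ≤ N := le_of_max_le_right hN
  calc P N {z | δ < |((N : ℝ) + 1)⁻¹ * energyObservable ϑ ((Φ N).flow s z) -
          ((N : ℝ) + 1)⁻¹ * energyObservable ϑ ((Φ N).flow t z)|}
      ≤ _ := measure_setOf_lt_abs_sub_le (Φ N) (P N) (hgood N) hϑ hC hC0 (hε N) hM hts hsu₁ hsu₂
          hm harith
    _ ≤ ENNReal.ofReal (κ / 3) + ENNReal.ofReal (κ / 3) + ENNReal.ofReal (κ / 3) :=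
        add_le_add (add_le_add ((measure_mono fun z hz => lt_of_le_of_lt (le_max_left K 1) hz).trans
          (hK N hN₁)) (hI N hN₂)) (hS N hN₃)
    _ = ENNReal.ofReal κ := by
        rw [← ENNReal.ofReal_add (by positivity) (by positivity),
          ← ENNReal.ofReal_add (by positivity) (by positivity)]
        congr 1
        ring

/-- **Tightness of the kinetic energy per particle under the local Gibbs laws** from the `t = 0`
law of large numbers of the conjunct (`energy_tight_of_tendstoHydroFieldsAt_zero` read at time `0`
on the good set). [folklore] -/
theorem configEnergy_tight_localGibbs (σ : ℝ) (a₀ θ₀ : T3 → ℝ) (u₀ : T3 → V3)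
    (Φ : (N : ℕ) → HardSphereFlow (Torus.geometry (Fin 3)) (hsDiameter σ N) (N + 1))
    (ρ θ : ℝ → T3 → ℝ) (u : ℝ → T3 → V3)
    (h0 : TendstoHydroFieldsAt (fun N => localGibbsLaw σ a₀ u₀ θ₀ N (Φ N)) Φ ρ u θ 0) :
    ∀ κ : ℝ, 0 < κ → ∃ K : ℝ, ∃ N₁ : ℕ, ∀ N, N₁ ≤ N →
      localGibbsLaw σ a₀ u₀ θ₀ N (Φ N) {z | K < ((N : ℝ) + 1)⁻¹ * configEnergy z} ≤
        ENNReal.ofReal κ := by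
  intro κ hκ
  obtain ⟨K, N₁, hK⟩ := energy_tight_of_tendstoHydroFieldsAt_zero σ a₀ θ₀ u₀ Φ ρ θ u h0 0 κ hκ
  refine ⟨K, N₁, fun N hN => le_trans (measure_mono fun z hz => ?_)
    ((measure_union_le ((Φ N).goodᶜ) {z | K < empiricalEnergyField ((Φ N).flow 0 z) fun _ => 1}).trans
      ?_)⟩
  · simp only [mem_setOf_eq, mem_union, mem_compl_iff] at hz ⊢
    by_cases hg : z ∈ (Φ N).good
    · right
      rw [(Φ N).flow_zero z hg, empiricalEnergyField_one_eq]
      simpa [Nat.cast_add_one] using hz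
    · exact Or.inl hg
  · rw [localGibbsLaw_compl_good, zero_add]
    exact hK N hN

/-- **The energy input of the fixed-time upgrade under the conjunct's hypotheses**, MODULO the two
windowed hypotheses `hcubic` (cubic streaming tail, ⇐ `EnergyCurrentTails` stmt-9235 by Markov and
Tonelli) and `hjump` (absolute collisional energy transfer): then
`s ↦ (N+1)⁻¹ Σᵢ ϑ(xᵢ(s))|vᵢ(s)|²/2` satisfies verbatim the hypothesis `hequi` of
`tendsto_measure_fixedTime_of_timeAverage`. These two hypotheses are exactly what the item's `X`
lacks (gap G1). [folklore] -/
theorem hequi_energy_localGibbs {σ : ℝ} (hσ : 0 < σ) (a₀ θ₀ : T3 → ℝ) (u₀ : T3 → V3)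
    (Φ : (N : ℕ) → HardSphereFlow (Torus.geometry (Fin 3)) (hsDiameter σ N) (N + 1))
    (ρ θ : ℝ → T3 → ℝ) (u : ℝ → T3 → V3)
    (h0 : TendstoHydroFieldsAt (fun N => localGibbsLaw σ a₀ u₀ θ₀ N (Φ N)) Φ ρ u θ 0)
    {ϑ : T3 → ℝ} (hϑ : Torus.IsContDiff 1 ϑ) (t : ℝ) {Δ₀ : ℝ} (hΔ₀ : 0 < Δ₀)
    (hcubic : ∀ η : ℝ, 0 < η → ∀ κ : ℝ, 0 < κ → ∃ M : ℝ, 0 ≤ M ∧ ∃ Δ : ℝ, 0 < Δ ∧ ∃ N₂ : ℕ,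
      ∀ N, N₂ ≤ N → localGibbsLaw σ a₀ u₀ θ₀ N (Φ N) {z | η < ((N : ℝ) + 1)⁻¹ *
        ∫ r in t..(t + Δ), ∑ i, {w : V3 | M < ‖w‖}.indicator (fun w => ‖w‖ ^ 3)
          ((Φ N).flow r z i).2} ≤ ENNReal.ofReal κ)
    (hjump : ∀ η : ℝ, 0 < η → ∀ κ : ℝ, 0 < κ → ∃ Δ : ℝ, 0 < Δ ∧ ∃ N₃ : ℕ, ∀ N, N₃ ≤ N →
      localGibbsLaw σ a₀ u₀ θ₀ N (Φ N) {z | η < hsDiameter σ N * ((N : ℝ) + 1)⁻¹ * (2⁻¹ *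
        collisionalTransferFunctional (Torus.geometry (Fin 3)) (hsDiameter σ N)
          (fun i _ pre post => |‖(post i).2‖ ^ 2 - ‖(pre i).2‖ ^ 2| / 2)
          (fun r => (Φ N).flow r z) t (t + Δ))} ≤ ENNReal.ofReal κ) :
    ∀ δ : ℝ, 0 < δ → ∀ κ : ℝ, 0 < κ → ∃ Δ : ℝ, 0 < Δ ∧ Δ ≤ Δ₀ ∧ ∃ N₀ : ℕ, ∀ N, N₀ ≤ N →
      ∀ s ∈ Ioo t (t + Δ),
        localGibbsLaw σ a₀ u₀ θ₀ N (Φ N)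
          {z | δ < |((N : ℝ) + 1)⁻¹ * energyObservable ϑ ((Φ N).flow s z) -
            ((N : ℝ) + 1)⁻¹ * energyObservable ϑ ((Φ N).flow t z)|} ≤ ENNReal.ofReal κ :=
  hequi_energy_of_energy_of_cubic_of_jump (fun N => (hsDiameter_pos hσ N).le)
    (fun N => localGibbsLaw σ a₀ u₀ θ₀ N (Φ N)) Φ
    (fun N => localGibbsLaw_compl_good σ a₀ θ₀ u₀ N (Φ N)) hϑ t hΔ₀
    (configEnergy_tight_localGibbs σ a₀ θ₀ u₀ Φ ρ θ u h0) hcubic hjump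

/-- **The energy observable at a FIXED instant from its time averages**: `havg` (time-averaged
identification near `t`, what a Young-measure / Březina–Feireisl run delivers) + `hcubic` + `hjump`
⇒ convergence in probability AT `t` (with `empiricalEnergyField z χ = N⁻¹ · energyObservable χ z`, in tree,
this is the energy conjunct of `TendstoHydroFieldsAt … t`; for its lower half alone see
`energyConjunct_of_lower`).
[folklore] -/
theorem tendsto_energyObservable_fixedTime_localGibbs {σ : ℝ} (hσ : 0 < σ) (a₀ θ₀ : T3 → ℝ)
    (u₀ : T3 → V3)
    (Φ : (N : ℕ) → HardSphereFlow (Torus.geometry (Fin 3)) (hsDiameter σ N) (N + 1))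
    (ρ θ : ℝ → T3 → ℝ) (u : ℝ → T3 → V3)
    (h0 : TendstoHydroFieldsAt (fun N => localGibbsLaw σ a₀ u₀ θ₀ N (Φ N)) Φ ρ u θ 0)
    {ϑ : T3 → ℝ} (hϑ : Torus.IsContDiff 1 ϑ) (t : ℝ) {Δ₀ : ℝ} (hΔ₀ : 0 < Δ₀)
    (G : ℝ → ℝ) (hG : ContinuousAt G t)
    (havg : ∀ δ : ℝ, 0 < δ → Tendsto (fun N => ∫⁻ s in Ioo t (t + Δ₀),
      localGibbsLaw σ a₀ u₀ θ₀ N (Φ N)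
        {z | δ < |((N : ℝ) + 1)⁻¹ * energyObservable ϑ ((Φ N).flow s z) - G s|}) atTop (𝓝 0))
    (hcubic : ∀ η : ℝ, 0 < η → ∀ κ : ℝ, 0 < κ → ∃ M : ℝ, 0 ≤ M ∧ ∃ Δ : ℝ, 0 < Δ ∧ ∃ N₂ : ℕ,
      ∀ N, N₂ ≤ N → localGibbsLaw σ a₀ u₀ θ₀ N (Φ N) {z | η < ((N : ℝ) + 1)⁻¹ *
        ∫ r in t..(t + Δ), ∑ i, {w : V3 | M < ‖w‖}.indicator (fun w => ‖w‖ ^ 3)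
          ((Φ N).flow r z i).2} ≤ ENNReal.ofReal κ)
    (hjump : ∀ η : ℝ, 0 < η → ∀ κ : ℝ, 0 < κ → ∃ Δ : ℝ, 0 < Δ ∧ ∃ N₃ : ℕ, ∀ N, N₃ ≤ N →
      localGibbsLaw σ a₀ u₀ θ₀ N (Φ N) {z | η < hsDiameter σ N * ((N : ℝ) + 1)⁻¹ * (2⁻¹ *
        collisionalTransferFunctional (Torus.geometry (Fin 3)) (hsDiameter σ N)
          (fun i _ pre post => |‖(post i).2‖ ^ 2 - ‖(pre i).2‖ ^ 2| / 2)
          (fun r => (Φ N).flow r z) t (t + Δ))} ≤ ENNReal.ofReal κ) :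
    ∀ δ : ℝ, 0 < δ → Tendsto (fun N => localGibbsLaw σ a₀ u₀ θ₀ N (Φ N)
      {z | δ < |((N : ℝ) + 1)⁻¹ * energyObservable ϑ ((Φ N).flow t z) - G t|}) atTop (𝓝 0) :=
  tendsto_measure_fixedTime_of_timeAverage (fun N => localGibbsLaw σ a₀ u₀ θ₀ N (Φ N))
    (fun N s z => ((N : ℝ) + 1)⁻¹ * energyObservable ϑ ((Φ N).flow s z)) G hG havg
    (hequi_energy_localGibbs hσ a₀ θ₀ u₀ Φ ρ θ u h0 hϑ t hΔ₀ hcubic hjump)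

end Summit.AtomisticToContinuum.HydrodynamicLimit.Theorems.JParityClosureEnergyModulus

end
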